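import Summits.RiemannHypothesis.RiemannHypothesis.Theorems.WeilTwoPrimeDeflE25EBase
import Summits.RiemannHypothesis.RiemannHypothesis.Theorems.WeilTwoPrimeDeflE25EDataDnE18
import Literature.NumberTheory.LFunctions.WeilBlockRowsPZ
import HarnessLib

/-!
# Even-sector deflated two-prime certificate E25E: the factored even inverse agrees with `D`, rows 28–31

`WeilCert.checkDnRow` (even block) for certificate E25E, by `decide +kernel`. Pure proof file.
-/

set_option linter.dupNamespace false

noncomputable section

namespace Summit.RiemannHypothesis.RiemannHypothesis.Theorems.EvenWinsBeyondArch

open Literature.NumberTheory.LFunctions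

set_option maxHeartbeats 0 in
/-- Row 28 of `DnE/LsE` is row 28 of the even `D` (certificate E25E). [folklore] -/
theorem checkDnRow0_28_weilCertDeflE25E : weilCertDeflE25EBase.checkDnRow weilCertDeflE25EDnE weilCertDeflE25ELsE 0 28 = true := by
  decide +kernel

set_option maxHeartbeats 0 in
/-- Row 29 of `DnE/LsE` is row 29 of the even `D` (certificate E25E). [folklore] -/
theorem checkDnRow0_29_weilCertDeflE25E : weilCertDeflE25EBase.checkDnRow weilCertDeflE25EDnE weilCertDeflE25ELsE 0 29 = true := by
  decide +kernel

set_option maxHeartbeats 0 in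
/-- Row 30 of `DnE/LsE` is row 30 of the even `D` (certificate E25E). [folklore] -/
theorem checkDnRow0_30_weilCertDeflE25E : weilCertDeflE25EBase.checkDnRow weilCertDeflE25EDnE weilCertDeflE25ELsE 0 30 = true := by
  decide +kernel

set_option maxHeartbeats 0 in
/-- Row 31 of `DnE/LsE` is row 31 of the even `D` (certificate E25E). [folklore] -/
theorem checkDnRow0_31_weilCertDeflE25E : weilCertDeflE25EBase.checkDnRow weilCertDeflE25EDnE weilCertDeflE25ELsE 0 31 = true := by
  decide +kernel


end Summit.RiemannHypothesis.RiemannHypothesis.Theorems.EvenWinsBeyondArch
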